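import Summits.Ventures.PercRepro.RankLevelSetBiIndepProfileAll

/-! # RankLevelSetBiIndepProfileAvoid — THE MEMBERS AVOIDING A FIXED SET: THE LEVEL-WISE FORM FROM THE ULC OF THE
RESTRICTED BI-INDEPENDENT PROFILE (night-1 g23, attempt 2; note proofs/NIGHT-1-BIINDEP-ULC.md §7)

For `A ⊆ E` the profile `D_r^{(A)} = #{S : #S = r, S and E ∖ S independent, S ∩ A = ∅}` is again ULC (paper §7: set the
`S`-side variables of `A` to `0` before the extraction — a nonnegative linear map). It is no longer symmetric: its
reflection `r ↦ D_{n−r}^{(A)}` counts the bi-independent sets CONTAINING `A`. At the tight layer its two ends are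
`D_q^{(A)} = #{Z ∈ 𝒵 : Z ∩ A = ∅}` and `D_p^{(A)} = #{Z ∈ 𝒵 : A ⊆ Z}`, and a bi-independent `t`-set avoiding `A`
contains a member avoiding `A`. Log-concave ⇒ unimodal ⇒ at every level `q < t < p`
  `C(p+q,t) · min(#{Z ∈ 𝒵 : Z ∩ A = ∅}, #{Z ∈ 𝒵 : A ⊆ Z}) ≤ C(p+q,q) · #{independent t-set UP-neighbours of the members avoiding A}`
— the level-wise inequality for the family of members avoiding `A` whenever it is not larger than the family containing
`A` (`A = ∅` is `RankLevelSetBiIndepProfileAll`). CONDITIONAL on the named fact `BiIndepAvoidULC M A` (the Lorentzian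
argument with the `A`-variables set to `0`; NOT proved here). Everything else is proved: the sequence lemma for the
minimum of the two ends (`lc_min_ends_ge`), the identification of both ends, the inclusion into the UP-neighbourhood.
Every declaration has a docstring; imports: the cell's own modules and Mathlib only. -/

namespace PercRepro

open Set Matroid Finset

/-! ## The sequence lemma with the minimum of the two ends -/

section Sequence

variable (d : ℕ → ℚ) (q p : ℕ)

/-- **The reversed sequence is log-concave**: `r ↦ d (q + p − r)` satisfies the same inequalities on `[q, p]`. -/
lemma lc_reverse (hlc : ∀ r, q + 1 ≤ r → r + 1 ≤ p → d (r - 1) * d (r + 1) ≤ d r ^ 2)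
    (r : ℕ) (hr : q + 1 ≤ r) (hr' : r + 1 ≤ p) :
    d (q + p - (r - 1)) * d (q + p - (r + 1)) ≤ d (q + p - r) ^ 2 := by
  have h := hlc (q + p - r) (by omega) (by omega)
  rw [show q + p - (r - 1) = q + p - r + 1 by omega, show q + p - (r + 1) = q + p - r - 1 by omega]
  linarith [h]

/-- **A positive log-concave sequence on `[q, p]` is at least the smaller of its two end values in between.** -/
lemma lc_min_ends_ge (hpos : ∀ r, q ≤ r → r ≤ p → 0 < d r)
    (hlc : ∀ r, q + 1 ≤ r → r + 1 ≤ p → d (r - 1) * d (r + 1) ≤ d r ^ 2)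
    (t : ℕ) (hqt : q ≤ t) (htp : t ≤ p) : min (d q) (d p) ≤ d t := by
  by_cases hend : d q ≤ d p
  · rw [min_eq_left hend]
    exact lc_symm_ge d q p hpos hlc hend t hqt htp
  · have hend' : d p ≤ d q := le_of_lt (not_le.mp hend)
    rw [min_eq_right hend']
    -- apply the lemma to the reversed sequence
    set d' : ℕ → ℚ := fun r => d (q + p - r) with hd'
    have hpos' : ∀ r, q ≤ r → r ≤ p → 0 < d' r := fun r hqr hrp => hpos (q + p - r) (by omega) (by omega)
    have hlc' : ∀ r, q + 1 ≤ r → r + 1 ≤ p → d' (r - 1) * d' (r + 1) ≤ d' r ^ 2 :=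
      fun r hr hr' => lc_reverse d q p hlc r hr hr'
    have hend'' : d' q ≤ d' p := by
      simp only [hd', show q + p - q = p by omega, show q + p - p = q by omega]
      exact hend'
    have h := lc_symm_ge d' q p hpos' hlc' hend'' (q + p - t) (by omega) (by omega)
    simp only [hd', show q + p - q = p by omega, show q + p - (q + p - t) = t by omega] at h
    exact h

end Sequence

/-! ## The restricted profile -/

variable {α : Type} (M : Matroid α) [M.Finite]

/-- **The bi-independent `r`-sets avoiding `A`.** -/
def biIndepAvoid (A : Set α) (r : ℕ) : Set (Set α) := {S ∈ biIndep M r | Disjoint S A}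

/-- They are finitely many. -/
lemma biIndepAvoid_finite (A : Set α) (r : ℕ) : (biIndepAvoid M A r).Finite :=
  (biIndep_finite M r).subset (fun _ h => h.1)

/-- **The restricted profile** `D_r^{(A)}`. -/
noncomputable def biIndepAvoidCount (A : Set α) (r : ℕ) : ℕ := (biIndepAvoid M A r).ncard

/-- **The normalised restricted profile** `D_r^{(A)} / C(#E, r)`. -/
noncomputable def biIndepAvoidNorm (A : Set α) (r : ℕ) : ℚ :=
  (biIndepAvoidCount M A r : ℚ) / ((M.E.ncard).choose r : ℚ)

omit [M.Finite] in
/-- **THE NAMED FACT, RESTRICTED TO THE SETS AVOIDING `A`** (a `Prop`, NOT proved here): `r ↦ D_r^{(A)}/C(n,r)` is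
log-concave with no internal zeros — the Lorentzian argument of the note §7 (the `A`-variables of the `S`-side set to
`0` before the extraction). `A = ∅` is `BiIndepULC`. -/
def BiIndepAvoidULC (A : Set α) : Prop :=
  (∀ r, 1 ≤ r → r + 1 ≤ M.E.ncard →
      biIndepAvoidNorm M A (r - 1) * biIndepAvoidNorm M A (r + 1) ≤ biIndepAvoidNorm M A r ^ 2) ∧
  (∀ a b c, a ≤ b → b ≤ c → 0 < biIndepAvoidCount M A a → 0 < biIndepAvoidCount M A c →
      0 < biIndepAvoidCount M A b)

/-- **The lower end**: the bi-independent `q`-sets avoiding `A` are the members avoiding `A` (tight layer). -/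
lemma biIndepAvoid_q_eq {p q : ℕ} (hE : M.E.ncard = p + q) (A : Set α) :
    biIndepAvoid M A q = {Z ∈ cellMembers M p q | Disjoint Z A} := by
  unfold biIndepAvoid
  rw [cellMembers_eq_biIndep M hE]

/-- **The upper end**: the bi-independent `p`-sets avoiding `A` correspond, by complementation, to the members
CONTAINING `A` (tight layer, `A ⊆ E`). -/
lemma biIndepAvoidCount_p_eq {p q : ℕ} (hE : M.E.ncard = p + q) {A : Set α} (hA : A ⊆ M.E) :
    biIndepAvoidCount M A p = {Z ∈ cellMembers M p q | A ⊆ Z}.ncard := by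
  unfold biIndepAvoidCount
  rw [cellMembers_eq_biIndep M hE]
  refine Set.ncard_congr (fun S _ => M.E \ S) ?_ ?_ ?_
  · rintro S ⟨hS, hSA⟩
    have h1 := mem_biIndep_compl M hS
    rw [hE, show p + q - p = q by omega] at h1
    refine ⟨h1, ?_⟩
    intro x hx
    exact ⟨hA hx, fun hxS => hSA.ne_of_mem hxS hx rfl⟩
  · rintro S T ⟨hS, -⟩ ⟨hT, -⟩ hST
    have h1 : M.E \ (M.E \ S) = M.E \ (M.E \ T) := by rw [hST]
    rwa [Set.sdiff_sdiff_cancel_left hS.1, Set.sdiff_sdiff_cancel_left hT.1] at h1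
  · rintro Z ⟨hZ, hAZ⟩
    refine ⟨M.E \ Z, ⟨?_, ?_⟩, Set.sdiff_sdiff_cancel_left hZ.1⟩
    · have h1 := mem_biIndep_compl M hZ
      rwa [hE, show p + q - q = p by omega] at h1
    · exact Set.disjoint_left.mpr (fun x hx hxA => hx.2 (hAZ hxA))

/-- **A bi-independent `t`-set avoiding `A` is an independent `t`-set UP-neighbour of the members avoiding `A`**
(tight layer, `p ≤ rank`, `q < t < p`). -/
lemma biIndepAvoid_subset_indepLevelNbhd {p q t : ℕ} (hE : M.E.ncard = p + q) (hrk : (p : ℕ∞) ≤ M.eRank)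
    (hqt : q < t) (htp : t < p) (A : Set α) :
    biIndepAvoid M A t ⊆ indepLevelNbhd M p q t {Z ∈ cellMembers M p q | Disjoint Z A} := by
  rintro S ⟨hS, hSA⟩
  have hS' : S ∈ indepLevelNbhd M p q t (cellMembers M p q) := by
    rw [indepLevelNbhd_members_eq_biIndep_of_le M hE hrk hqt htp]; exact hS
  obtain ⟨⟨hSE, hq, hp, Z, hZ, hZS⟩, hind, hcard⟩ := hS'
  exact ⟨⟨hSE, hq, hp, Z, ⟨hZ, hSA.mono_left hZS⟩, hZS⟩, hind, hcard⟩

/-- **THE LEVEL-WISE FORM FOR THE MEMBERS AVOIDING `A`** (tight layer `#E = p + q`, `A ⊆ E`, `q < t < p`), CONDITIONAL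
on `BiIndepAvoidULC M A`: `C(p+q,t) · min(#{Z ∈ 𝒵 : Z ∩ A = ∅}, #{Z ∈ 𝒵 : A ⊆ Z}) ≤ C(p+q,q) · #{independent t-set
UP-neighbours of the members avoiding A}`. -/
theorem levelHallUp_avoid_of_biIndepAvoidULC {A : Set α} (hULC : BiIndepAvoidULC M A) (hA : A ⊆ M.E)
    {p q t : ℕ} (hE : M.E.ncard = p + q) (hqt : q < t) (htp : t < p) :
    ((p + q).choose t : ℚ) *
        (min ({Z ∈ cellMembers M p q | Disjoint Z A}.ncard : ℚ) ({Z ∈ cellMembers M p q | A ⊆ Z}.ncard : ℚ)) ≤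
      ((p + q).choose q : ℚ) *
        ((indepLevelNbhd M p q t {Z ∈ cellMembers M p q | Disjoint Z A}).ncard : ℚ) := by
  obtain ⟨hlc, hnz⟩ := hULC
  have hq_eq : biIndepAvoidCount M A q = {Z ∈ cellMembers M p q | Disjoint Z A}.ncard := by
    unfold biIndepAvoidCount; rw [biIndepAvoid_q_eq M hE A]
  have hp_eq := biIndepAvoidCount_p_eq M hE hA
  rw [← hq_eq, ← hp_eq]
  -- trivial cases: an end count is zero
  by_cases hq0 : biIndepAvoidCount M A q = 0
  · rw [hq0, Nat.cast_zero, min_eq_left (by positivity), mul_zero]; positivity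
  by_cases hp0 : biIndepAvoidCount M A p = 0
  · rw [hp0, Nat.cast_zero, min_eq_right (by positivity), mul_zero]; positivity
  have hqpos : 0 < biIndepAvoidCount M A q := Nat.pos_of_ne_zero hq0
  have hppos : 0 < biIndepAvoidCount M A p := Nat.pos_of_ne_zero hp0
  -- the members avoiding A are nonempty, hence p ≤ rank
  have hrk : (p : ℕ∞) ≤ M.eRank := by
    have hne : (biIndepAvoid M A q).Nonempty := (Set.ncard_pos (biIndepAvoid_finite M A q)).mp hqpos
    obtain ⟨Z, hZ⟩ := hne
    rw [biIndepAvoid_q_eq M hE A] at hZ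
    exact eRank_ge_of_mem_cellMembers M hZ.1
  -- the profile is positive on [q, p]
  have hpos : ∀ r, q ≤ r → r ≤ p → 0 < biIndepAvoidNorm M A r := by
    intro r hqr hrp
    unfold biIndepAvoidNorm
    have hD : 0 < biIndepAvoidCount M A r := hnz q r p hqr hrp hqpos hppos
    have hC : 0 < ((M.E.ncard).choose r : ℚ) := by
      exact_mod_cast Nat.choose_pos (by omega)
    exact div_pos (by exact_mod_cast hD) hC
  have hlc' : ∀ r, q + 1 ≤ r → r + 1 ≤ p →
      biIndepAvoidNorm M A (r - 1) * biIndepAvoidNorm M A (r + 1) ≤ biIndepAvoidNorm M A r ^ 2 :=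
    fun r hr hr' => hlc r (by omega) (by omega)
  have hmain := lc_min_ends_ge (biIndepAvoidNorm M A) q p hpos hlc' t hqt.le htp.le
  -- the t-sets avoiding A sit inside the UP-neighbourhood
  have hsub : biIndepAvoidCount M A t ≤
      (indepLevelNbhd M p q t {Z ∈ cellMembers M p q | Disjoint Z A}).ncard := by
    unfold biIndepAvoidCount
    exact Set.ncard_le_ncard (biIndepAvoid_subset_indepLevelNbhd M hE hrk hqt htp A)
      ((levelNbhd_finite p q t _).subset (indepLevelNbhd_subset p q t _))
  -- unfold the normalisation and conclude
  unfold biIndepAvoidNorm at hmain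
  rw [hE] at hmain
  have hCq : 0 < ((p + q).choose q : ℚ) := by exact_mod_cast Nat.choose_pos (by omega)
  have hCp : 0 < ((p + q).choose p : ℚ) := by exact_mod_cast Nat.choose_pos (by omega)
  have hCt : 0 < ((p + q).choose t : ℚ) := by exact_mod_cast Nat.choose_pos (by omega)
  have hsym : ((p + q).choose p : ℚ) = ((p + q).choose q : ℚ) := by
    exact_mod_cast Nat.choose_symm_add (a := p) (b := q)
  rw [hsym] at hmain
  have hminC : min ((biIndepAvoidCount M A q : ℚ) / ((p + q).choose q : ℚ))
      ((biIndepAvoidCount M A p : ℚ) / ((p + q).choose q : ℚ)) =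
      (min (biIndepAvoidCount M A q : ℚ) (biIndepAvoidCount M A p : ℚ)) / ((p + q).choose q : ℚ) := by
    rw [min_div_div_right hCq.le]
  rw [hminC, div_le_div_iff₀ hCq hCt] at hmain
  have hsub' : (biIndepAvoidCount M A t : ℚ) ≤
      ((indepLevelNbhd M p q t {Z ∈ cellMembers M p q | Disjoint Z A}).ncard : ℚ) := by exact_mod_cast hsub
  nlinarith [hmain, hsub', hCq]

end PercRepro
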